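import Literature.Analysis.FluidPDE.TorusClassicalNSForcedLocalExistence
import Literature.Analysis.FluidPDE.NSRPerturbation
import Literature.Analysis.FluidPDE.TorusNSGevreyCoefficients
import Literature.Analysis.FluidPDE.ScalarFourierData
import Literature.Analysis.FunctionSpaces.TorusTrigPoly
import HarnessLib

/-!
# Local classical solutions of the Navier–Stokes system on `T^d` with a TIME-DEPENDENT force from an
# ARBITRARY smooth datum, with a life span uniform in the start time (the restart theorem)

Analysis/FluidPDE proof file (theorems only; no definitions, no named facts).  The tree's short-time theory
in the classical vocabulary `Torus.IsClassicalNSSolutionOn` covers (i) the unforced system from smooth data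
(`Torus.exists_classicalNS_smooth`, `TorusNSSmoothLocalExistence`), (ii) a STEADY force from the zero datum
(`Torus.exists_classicalNS_forced_zero_datum`, `TorusClassicalNSForcedLocalExistence`) and (iii) the
perturbation system around a given background with the force absorbed by the background
(`Torus.perturbedNS_exists_local`, `#d ≤ 3`).  This file adds the genuinely forced case that continuation
arguments for a time-dependent body force need (Majda–Bertozzi 2002, Thm. 3.4, stated with a force
`F ∈ C¹([0,∞); V^m)`; Robinson–Rodrigo–Sadowski 2016, Thm. 6.8; Constantin–Foias 1988, Thm. 9.4 / Ch. 10: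
the local strong solution exists on a time interval whose length depends only on the size of the datum
and of the force):

* `Torus.IsClassicalNSSolutionOn.of_background_corrector` — ALGEBRA: if `U` is jointly smooth with
  divergence-free slices on `[0, θ] × T^d` and `(v, q)` solves the stress-forced perturbation system (3.2) of
  Cheskidov–Luo around `U` with the explicit stress `R = ½(U⊗U + U⊗U) − (∇U + ∇Uᵀ)` (so that
  `div R = (U·∇)U − ΔU`, tree `Torus.tensorDivergence_linStress` / `…_symGrad`), then `u = U + v`, `p = q`
  is a classical solution of NS₁ with the force `∂ₜU` and `u(0) = U(0)` — the force AND the datum are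
  absorbed by the background, no inverse Laplacian is needed;
* `Torus.IsClassicalNSSolutionOn.rescale_translate` — the parabolic rescaling
  `(u, p)(t, x) = (a v(a(t − t₀)), a² q(a(t − t₀)))` from `[0, θ]` (viscosity `μ`, force `f₁`) to
  `[t₀, t₀ + θ/a]` (viscosity `aμ`, force `a² f₁(a(t − t₀))`), time-dependent twin of the tree's
  `Torus.IsClassicalNSSolutionOn.viscosity_rescale_Icc`;
* `Torus.exists_classicalNS_unitVisc_of_background` — ANALYSIS at unit viscosity: the Fourier–Picard engine
  `CorrectorFourier.isLinearizedNSSolutionOn_vel` (Cheskidov–Luo 2022, §3.1, Prop. 3.2, PROVED in the tree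
  for time-dependent background and stress) fed with the decay constants of `U` and `R`, which are computed
  here from ONE number: a uniform bound `A` of order `2#d + 2` on the Fourier coefficients of the components
  of `U` (products ↦ lattice convolutions `ScalarFourier.mFourierCoeff_mul`, `…hasDecay_lconv_mixed`;
  derivatives ↦ symbols `Torus.mFourierCoeff_partialDeriv`, `…hasDecay_dsym_mul`); the life span
  `θ₀ = θ₀(d, A) > 0` comes from `CorrectorFourier.exists_threshold`;
* `Torus.exists_classicalNS_forced_restart` — **THE RESTART THEOREM** (potential form of the force):
  for `ν > 0`, `a < b`, a field `ū` jointly smooth with divergence-free slices on `[a, b] × T^d` and a level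
  `M`, there is `θ > 0` such that from EVERY `t₀ ∈ [a, b]` with `t₀ + θ ≤ b` and EVERY smooth divergence-free
  datum `u₀` whose component Fourier coefficients obey `‖𝓕(u₀ⱼ)(k)‖ ≤ M (1 + ‖k‖)^{-(2#d+2)}`, the system
  `∂ₜu + (u·∇)u = νΔu − ∇p + ∂ₜū`, `div u = 0` has a classical solution on `[t₀, t₀ + θ] × T^d` with
  `u(t₀) = u₀` (background `U = u₀ − ū(t₀) + ū`, unit-viscosity variables `s = ν(t − t₀)`, rescaling);
  `Torus.exists_classicalNS_forced_local` — the qualitative corollary from one datum at time `a`.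

The force is taken in POTENTIAL FORM `f = ∂ₜū` (one-sided derivative within `[a, b]`): every smooth force
is of this form (`ū = ∫ f`), and for the consumer at hand (cell `ad-ideate`, `SawtoothCascade.DriftFree`:
`planarForce P = ∂ₜ(P.field)`) the primitive is the given cascade field itself.  An optional identification
`∂ₜū = f` on `[a, b]` is threaded through the statements so that they conclude with the user's name of the
force.  No mean-zero hypothesis is needed anywhere (the corrector has mean zero; the background carries the
mean).  WHAT THIS IS NOT: no uniqueness (tree: `velocity_unique`), no continuation, no a priori estimate.

## Tree / Mathlib search

Reused: `CorrectorFourier.isLinearizedNSSolutionOn_vel`, `CorrectorFourier.exists_threshold`,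
`CorrectorFourier.hasDecay_driftCoeff/stressCoeff_of_forall` (`CorrectorFourierSolution/Picard/Data`),
`Torus.IsLinearizedNSSolutionOn` (`NavierStokesConcentrationCorrectorFacts`), `Torus.linStress`, `Torus.symGrad`,
`Torus.tensorDivergence_linStress/symGrad`, `IsSmoothSpaceTimeOn.linStress/symGrad` (`NSRPerturbation`),
`Torus.tensorDivergence_sub`, `…const_smul_apply`, `ScalarFourier.mFourierCoeff_mul`,
`ScalarFourier.exists_hasDecay_mFourierCoeff(_spaceTime)`, `ScalarFourier.hasDecay_lconv_mixed`,
`ScalarFourier.hasDecay_dsym_mul`, `Torus.mFourierCoeff_partialDeriv`, `Torus.partialDeriv_ofReal_apply`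
(`TorusNSGevreyCoefficients`), `Torus.mFourierCoeff_sub` (`TorusTrigPoly`); template
`Torus.exists_classicalNS_forced_zero_datum_one`, `….viscosity_rescale_Icc`.
`lean search 'forced_restart|exists_classicalNS_forced_local|of_background_corrector'`: no hits.

## References

* A. J. Majda, A. L. Bertozzi, *Vorticity and Incompressible Flow*, CUP 2002, Thm. 3.4 (local existence with
  forcing, life span from the size of datum and force), §3.2.3. [MajdaBertozziCUP2002]
* A. Cheskidov, X. Luo, *Sharp nonuniqueness for the Navier–Stokes equations*, Invent. Math. 229 (2022),
  §3.1 (3.2), Prop. 3.2. [CheskidovLuo2022]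
* P. Constantin, C. Foias, *Navier–Stokes Equations*, Univ. Chicago Press 1988, Thm. 9.4, Ch. 10.
  [ConstantinFoiasNSE1988]
* J. C. Robinson, J. L. Rodrigo, W. Sadowski, *The Three-Dimensional Navier–Stokes Equations*, CUP 2016,
  Thm. 6.8, §8.1. [RobinsonRodrigoSadowskiCUP2016]
-/

noncomputable section

open MeasureTheory Set Function Filter UnitAddTorus
open scoped ContDiff InnerProductSpace Topology

namespace Literature.Analysis.FluidPDE

open Literature.Analysis.FunctionSpaces
open CorrectorFourier ScalarFourier
open FourierNS (HasDecay)

variable {d : Type*} [Fintype d] [DecidableEq d]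

/-! ### §1 The explicit stress of a background and its divergence -/

section Stress

variable {U : UnitAddTorus d → EuclideanSpace ℝ d}

/-- **`div (½(U⊗U + U⊗U) − (∇U + ∇Uᵀ)) = (U·∇)U − ΔU`** for a smooth divergence-free field (tree:
`div (u⊗w + w⊗u) = (u·∇)w + (w·∇)u`, `div (∇w + ∇wᵀ) = Δw`). [folklore] -/
private theorem Torus.tensorDivergence_backgroundStress (hU : Torus.IsSmooth U) (hdiv : Torus.IsDivFree U)
    (x : UnitAddTorus d) :
    Torus.tensorDivergence (fun y j => (1 / 2 : ℝ) • Torus.linStress U U y j - Torus.symGrad U y j) x =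
      Torus.convect U U x - Torus.laplacian U x := by
  have hL : Torus.IsSmooth (Torus.linStress U U) := hU.linStress hU
  have hS : Torus.IsSmooth (Torus.symGrad U) := hU.symGrad
  have hL' : Torus.IsSmooth (fun y j => (1 / 2 : ℝ) • Torus.linStress U U y j) := by
    have : (fun y j => (1 / 2 : ℝ) • Torus.linStress U U y j) = (1 / 2 : ℝ) • Torus.linStress U U := rfl
    rw [this]
    exact hL.smul _
  rw [Torus.tensorDivergence_sub hL' hS x,
    Torus.tensorDivergence_const_smul_apply (hL.isContDiff (by simp)) (1 / 2 : ℝ) x,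
    Torus.tensorDivergence_linStress hU hU hdiv hdiv x, Torus.tensorDivergence_symGrad hU hdiv x]
  rw [← two_smul ℝ (Torus.convect U U x), smul_smul]
  norm_num

end Stress

/-! ### §2 Algebra: background plus corrector solves the forced system at unit viscosity -/

section Absorb

variable {θ : ℝ} {U v : ℝ → UnitAddTorus d → EuclideanSpace ℝ d} {q : ℝ → UnitAddTorus d → ℝ}

/-- **Background plus corrector.** Let `U` be jointly smooth with divergence-free slices on `[0, θ] × T^d`,
`θ > 0`, and let `(v, q)` solve the stress-forced perturbation system (3.2) around `U` with the stress
`R = ½(U⊗U + U⊗U) − (∇U + ∇Uᵀ)`:  `∂ₜv + (v·∇)v + (U·∇)v + (v·∇)U + ∇q = Δv − div R`, `div v = 0`,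
`v(0) = 0`.  Then `u = U + v`, `p = q` is a classical solution of the Navier–Stokes system at unit viscosity
with the force `∂ₜU` (one-sided derivative within `[0, θ]`) and `u(0) = U(0)`: indeed
`div R = (U·∇)U − ΔU`, so `∂ₜu + (u·∇)u − Δu + ∇q = ∂ₜU` (Cheskidov–Luo 2022, §3.1: "if `u` solves NS then
`u + v` solves NS" — here run backwards with a background that solves nothing). [cite: CheskidovLuo2022, §3.1 (3.2)] -/
theorem _root_.Literature.Analysis.FunctionSpaces.Torus.IsClassicalNSSolutionOn.of_background_corrector
    (hθ : 0 < θ) (hU : Torus.IsSmoothSpaceTimeOn (Icc 0 θ) U) (hUdiv : ∀ t ∈ Icc 0 θ, Torus.IsDivFree (U t))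
    (hsol : Torus.IsLinearizedNSSolutionOn U
      (fun t y j => (1 / 2 : ℝ) • Torus.linStress (U t) (U t) y j - Torus.symGrad (U t) y j) 0 θ v q) :
    Torus.IsClassicalNSSolutionOn (Icc 0 θ) 1 (Torus.timeDerivWithin (Icc 0 θ) U)
      (fun t x => U t x + v t x) q ∧ (fun x => U 0 x + v 0 x) = U 0 := by
  have hUD : UniqueDiffOn ℝ (Icc 0 θ) := uniqueDiffOn_Icc hθ
  refine ⟨⟨hU.add hsol.smooth_v, hsol.smooth_q, fun t ht x => ?_, fun t ht => ?_⟩, ?_⟩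
  · have hUt : Torus.IsSmooth (U t) := hU.isSmooth_slice ht
    have hvt : Torus.IsSmooth (v t) := hsol.smooth_v.isSmooth_slice ht
    have hU1 : Torus.IsContDiff 1 (U t) := hUt.isContDiff (by simp)
    have hv1 : Torus.IsContDiff 1 (v t) := hvt.isContDiff (by simp)
    have hm := hsol.momentum t ht x
    rw [Torus.tensorDivergence_backgroundStress hUt (hUdiv t ht) x] at hm
    have hdt : Torus.timeDerivWithin (Icc 0 θ) (fun s y => U s y + v s y) t x =
        Torus.timeDerivWithin (Icc 0 θ) U t x + Torus.timeDerivWithin (Icc 0 θ) v t x :=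
      ((hU.hasDerivWithinAt_slice ht x).add (hsol.smooth_v.hasDerivWithinAt_slice ht x)).derivWithin (hUD t ht)
    rw [hdt, Torus.convect_add_left (U t) (v t) (fun y => U t y + v t y) x,
      Torus.convect_add_right (U t) hU1 hv1 x, Torus.convect_add_right (v t) hU1 hv1 x,
      Torus.laplacian_add_apply hUt hvt x, one_smul]
    linear_combination (norm := skip) hm
    abel
  · exact Torus.IsDivFree.add ((hU.isSmooth_slice ht).isContDiff (by simp))
      ((hsol.smooth_v.isSmooth_slice ht).isContDiff (by simp)) (hUdiv t ht) (hsol.divFree t ht)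
  · funext x
    rw [hsol.initial x, add_zero]

end Absorb

/-! ### §3 Parabolic rescaling and time translation -/

section Rescale

/-- **Parabolic rescaling with time translation** of classical solutions: if `(v, q)` is a classical solution
of NS_μ(f₁) on `[0, θ] × T^d` (time-dependent force) and `a > 0`, then
`(u, p)(t, x) = (a v(a(t − t₀), x), a² q(a(t − t₀), x))` is a classical solution of NS_{aμ} with the force
`a² f₁(a(t − t₀), ·)` on `[t₀, t₀ + θ/a] × T^d` (joint smoothness composes with the affine map
`(t, y) ↦ (a(t − t₀), y)`; the one-sided time derivative is the chain rule; every term of the momentum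
equation scales by `a²`) — time-dependent twin of the tree's `viscosity_rescale_Icc`; the time–amplitude member
of the rescaling family `u_{λ,α} = λ^α u(λx, λ²t)` of Robinson–Rodrigo–Sadowski 2016, Introduction, (13) (with
`λ² = a` in time only, the viscosity rescales). [cite: RobinsonRodrigoSadowskiCUP2016, Introduction "Rescaling of solutions" (13)] -/
theorem _root_.Literature.Analysis.FunctionSpaces.Torus.IsClassicalNSSolutionOn.rescale_translate
    {μ θ a t₀ : ℝ} {f₁ v : ℝ → UnitAddTorus d → EuclideanSpace ℝ d} {q : ℝ → UnitAddTorus d → ℝ}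
    (h : Torus.IsClassicalNSSolutionOn (Icc 0 θ) μ f₁ v q) (ha : 0 < a) (hθ : 0 < θ) :
    Torus.IsClassicalNSSolutionOn (Icc t₀ (t₀ + θ / a)) (a * μ) (fun t x => a ^ 2 • f₁ (a * (t - t₀)) x)
      (fun t x => a • v (a * (t - t₀)) x) fun t x => a ^ 2 * q (a * (t - t₀)) x := by
  have hmaps : MapsTo (fun t : ℝ => a * (t - t₀)) (Icc t₀ (t₀ + θ / a)) (Icc 0 θ) := fun t ht => by
    refine ⟨mul_nonneg ha.le (by linarith [ht.1]), ?_⟩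
    have h2 : t - t₀ ≤ θ / a := by linarith [ht.2]
    calc a * (t - t₀) ≤ a * (θ / a) := mul_le_mul_of_nonneg_left h2 ha.le
      _ = θ := mul_div_cancel₀ θ ha.ne'
  have hφ : ContDiff ℝ ((⊤ : ℕ∞) : WithTop ℕ∞)
      (fun z : ℝ × EuclideanSpace ℝ d => ((a * (z.1 - t₀), z.2) : ℝ × EuclideanSpace ℝ d)) :=
    (contDiff_const.mul (contDiff_fst.sub contDiff_const)).prodMk contDiff_snd
  have hφmaps : MapsTo (fun z : ℝ × EuclideanSpace ℝ d => ((a * (z.1 - t₀), z.2) : ℝ × EuclideanSpace ℝ d))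
      (Icc t₀ (t₀ + θ / a) ×ˢ univ) (Icc 0 θ ×ˢ univ) := fun z hz =>
    mk_mem_prod (hmaps (mem_prod.1 hz).1) (mem_univ _)
  have hθa : t₀ < t₀ + θ / a := by linarith [div_pos hθ ha]
  have hUD : UniqueDiffOn ℝ (Icc t₀ (t₀ + θ / a)) := uniqueDiffOn_Icc hθa
  refine ⟨?_, ?_, fun t ht x => ?_, fun t ht x => ?_⟩
  · have h1 : Torus.IsSmoothSpaceTimeOn (Icc t₀ (t₀ + θ / a)) (fun t x => v (a * (t - t₀)) x) :=
      h.smooth_velocity.comp hφ.contDiffOn hφmaps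
    exact h1.const_smul a
  · have h1 : Torus.IsSmoothSpaceTimeOn (Icc t₀ (t₀ + θ / a)) (fun t x => q (a * (t - t₀)) x) :=
      h.smooth_pressure.comp hφ.contDiffOn hφmaps
    have h2 := h1.const_smul (a ^ 2)
    simpa only [smul_eq_mul] using h2
  · have hat : a * (t - t₀) ∈ Icc 0 θ := hmaps ht
    have hvs : Torus.IsSmooth (v (a * (t - t₀))) := h.smooth_velocity.isSmooth_slice hat
    have hqs : Torus.IsSmooth (q (a * (t - t₀))) := h.smooth_pressure.isSmooth_slice hat
    have h1 : Torus.timeDerivWithin (Icc t₀ (t₀ + θ / a)) (fun t x => a • v (a * (t - t₀)) x) t x =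
        a • (a • Torus.timeDerivWithin (Icc 0 θ) v (a * (t - t₀)) x) := by
      have hg : HasDerivWithinAt (fun s => v s x) (Torus.timeDerivWithin (Icc 0 θ) v (a * (t - t₀)) x)
          (Icc 0 θ) (a * (t - t₀)) := h.smooth_velocity.hasDerivWithinAt_slice hat x
      have hh : HasDerivWithinAt (fun s : ℝ => a * (s - t₀)) a (Icc t₀ (t₀ + θ / a)) t := by
        simpa using ((hasDerivWithinAt_id t (Icc t₀ (t₀ + θ / a))).sub_const t₀).const_mul a
      have hcomp := (hg.scomp t hh hmaps).const_smul a
      exact hcomp.derivWithin (hUD t ht)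
    have h2 : Torus.convect (fun x => a • v (a * (t - t₀)) x) (fun x => a • v (a * (t - t₀)) x) x =
        a • (a • Torus.convect (v (a * (t - t₀))) (v (a * (t - t₀))) x) := by
      change Torus.fderiv (a • v (a * (t - t₀))) x (a • v (a * (t - t₀)) x) = _
      rw [Torus.fderiv_const_smul (hvs.isContDiff (by simp)), FunLike.coe_smul, Pi.smul_apply, map_smul]
      rfl
    have h3 : Torus.gradient (fun x => a ^ 2 * q (a * (t - t₀)) x) x =
        a ^ 2 • Torus.gradient (q (a * (t - t₀))) x := by
      change Torus.gradient (a ^ 2 • q (a * (t - t₀))) x = _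
      exact Torus.gradient_const_smul (hqs.isContDiff (by simp)) _ _
    have h4 : Torus.laplacian (fun x => a • v (a * (t - t₀)) x) x = a • Torus.laplacian (v (a * (t - t₀))) x := by
      change Torus.laplacian (a • v (a * (t - t₀))) x = _
      exact Torus.laplacian_const_smul_apply hvs a x
    have hm := h.momentum (a * (t - t₀)) hat x
    have e1 : a * μ * a = a * a * μ := by ring
    rw [h1, h2, h3, h4, smul_smul, smul_smul, ← smul_add, hm, smul_add, smul_sub, smul_smul, smul_smul, e1,
      pow_two]
  · have hat : a * (t - t₀) ∈ Icc 0 θ := hmaps ht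
    have hvs : Torus.IsSmooth (v (a * (t - t₀))) := h.smooth_velocity.isSmooth_slice hat
    change Torus.divergence (a • v (a * (t - t₀))) x = 0
    rw [Torus.divergence_const_smul (hvs.isContDiff (by simp)), h.divFree (a * (t - t₀)) hat x, mul_zero]

/-- Changing the name of the force: a classical solution for `f` is one for any `g` that agrees with `f`
pointwise on the time set. [folklore] -/
private theorem _root_.Literature.Analysis.FunctionSpaces.Torus.IsClassicalNSSolutionOn.congr_force {S : Set ℝ} {ν : ℝ}
    {f g u : ℝ → UnitAddTorus d → EuclideanSpace ℝ d} {p : ℝ → UnitAddTorus d → ℝ}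
    (h : Torus.IsClassicalNSSolutionOn S ν f u p) (hfg : ∀ t ∈ S, ∀ x, f t x = g t x) :
    Torus.IsClassicalNSSolutionOn S ν g u p where
  smooth_velocity := h.smooth_velocity
  smooth_pressure := h.smooth_pressure
  momentum t ht x := by rw [← hfg t ht x]; exact h.momentum t ht x
  divFree := h.divFree

end Rescale

/-! ### §4 The decay constants of the background and of its stress; unit-viscosity existence -/

section UnitVisc

/-- Entries of the background stress `R = ½(U⊗U + U⊗U) − (∇U + ∇Uᵀ)`: `Rₗⱼ = Uₗ Uⱼ − ∂ⱼUₗ − ∂ₗUⱼ`. [folklore] -/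
private theorem Torus.backgroundStress_entry {U : UnitAddTorus d → EuclideanSpace ℝ d} (hU : Torus.IsSmooth U)
    (y : UnitAddTorus d) (l j : d) :
    ((1 / 2 : ℝ) • Torus.linStress U U y j - Torus.symGrad U y j) l =
      U y l * U y j - Torus.partialDeriv j (fun z => U z l) y - Torus.partialDeriv l (fun z => U z j) y := by
  rw [PiLp.sub_apply, PiLp.smul_apply, Torus.linStress_apply, Torus.symGrad_apply (hU.isContDiff (by simp)),
    smul_eq_mul]
  ring

/-- The complexified entries of the background stress in terms of the complexified components
`Uₗ : ℂ`: `(Rₗⱼ : ℂ) = Uₗ Uⱼ − ∂ⱼUₗ − ∂ₗUⱼ`. [folklore] -/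
private theorem Torus.backgroundStress_entryC {U : UnitAddTorus d → EuclideanSpace ℝ d} (hU : Torus.IsSmooth U)
    (l j : d) :
    (fun y => ((((1 / 2 : ℝ) • Torus.linStress U U y j - Torus.symGrad U y j) l : ℝ) : ℂ)) =
      fun y => (fun z => ((U z l : ℝ) : ℂ)) y * (fun z => ((U z j : ℝ) : ℂ)) y -
        Torus.partialDeriv j (fun z => ((U z l : ℝ) : ℂ)) y - Torus.partialDeriv l (fun z => ((U z j : ℝ) : ℂ)) y := by
  funext y
  rw [Torus.backgroundStress_entry hU y l j, NSGevrey.partialDeriv_ofReal_apply hU j l y,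
    NSGevrey.partialDeriv_ofReal_apply hU l j y]
  push_cast
  ring

/-- **Decay of the Fourier coefficients of the stress entries** from a bound `A` of order `2#d + 2` on the
coefficients of the components of `U`: products are lattice convolutions (`𝓕(fg) = 𝓕f ⋆ 𝓕g`,
`ScalarFourier.mFourierCoeff_mul`, decay `ScalarFourier.hasDecay_lconv_mixed`) and derivatives are symbols
(`𝓕(∂ⱼg)(k) = 2πi kⱼ 𝓕g(k)`, Grafakos 2014, Prop. 3.2.6 (8), one order lost,
`ScalarFourier.hasDecay_dsym_mul`). [folklore] -/
private theorem Torus.hasDecay_backgroundStress_entry {U : UnitAddTorus d → EuclideanSpace ℝ d} (hU : Torus.IsSmooth U)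
    {A : ℝ} (hA : 0 ≤ A)
    (hUA : ∀ j, HasDecay (latOrder d + 2) A (fun k => mFourierCoeff (fun x => ((U x j : ℝ) : ℂ)) k)) (l j : d) :
    HasDecay (latOrder d + 1)
      (2 ^ (latOrder d + 1) * latMass d * (A * A + A * A) + 2 * Real.pi * A + 2 * Real.pi * A)
      (fun k => mFourierCoeff (fun y => ((((1 / 2 : ℝ) • Torus.linStress U U y j - Torus.symGrad U y j) l : ℝ) : ℂ)) k) := by
  -- the complexified components and their regularity
  set Ul : UnitAddTorus d → ℂ := fun z => ((U z l : ℝ) : ℂ) with hUl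
  set Uj : UnitAddTorus d → ℂ := fun z => ((U z j : ℝ) : ℂ) with hUj
  have hsl : Torus.IsSmooth Ul := (hU.apply l).comp_clm Complex.ofRealCLM
  have hsj : Torus.IsSmooth Uj := (hU.apply j).comp_clm Complex.ofRealCLM
  rw [Torus.backgroundStress_entryC hU l j]
  -- the three coefficient sequences
  have hK : latOrder d + 1 ≤ latOrder d + 2 := by omega
  have hK0 : latOrder d ≤ latOrder d + 2 := by omega
  have hprod : HasDecay (latOrder d + 1) (2 ^ (latOrder d + 1) * latMass d * (A * A + A * A))
      (fun k => mFourierCoeff (fun y => Ul y * Uj y) k) := by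
    have h := hasDecay_lconv_mixed hA hA ((hUA l).of_le hK0) ((hUA l).of_le hK) ((hUA j).of_le hK0)
      ((hUA j).of_le hK)
    intro k
    dsimp only
    rw [mFourierCoeff_mul hsl.continuous (summable_norm_mFourierCoeff hsl) hsj.continuous k]
    exact h k
  have hder : ∀ (i : d) {g : UnitAddTorus d → ℂ}, Torus.IsSmooth g →
      HasDecay (latOrder d + 2) A (fun k => mFourierCoeff g k) →
      HasDecay (latOrder d + 1) (2 * Real.pi * A) (fun k => mFourierCoeff (Torus.partialDeriv i g) k) := by
    intro i g hg hgA k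
    have h := hasDecay_dsym_mul hgA i k
    dsimp only at h ⊢
    rw [Torus.mFourierCoeff_partialDeriv hg i k, smul_eq_mul, ← dsym_apply]
    exact h
  have hd1 := hder j hsl (hUA l)
  have hd2 := hder l hsj (hUA j)
  -- combine
  intro k
  dsimp only
  have hi1 : Integrable (fun y => Ul y * Uj y) volume :=
    (show Torus.IsSmooth (fun y => Ul y * Uj y) from hsl.mul hsj).integrable
  have hi2 : Integrable (Torus.partialDeriv j Ul) volume := (hsl.partialDeriv j).integrable
  have hi3 : Integrable (Torus.partialDeriv l Uj) volume := (hsj.partialDeriv l).integrable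
  have e : (fun y => Ul y * Uj y - Torus.partialDeriv j Ul y - Torus.partialDeriv l Uj y) =
      ((fun y => Ul y * Uj y) - Torus.partialDeriv j Ul) - Torus.partialDeriv l Uj := by
    funext y; simp only [Pi.sub_apply]
  rw [e, Torus.mFourierCoeff_sub (hi1.sub hi2) hi3, Torus.mFourierCoeff_sub hi1 hi2]
  have hw : 0 ≤ ((1 + ‖k‖) ^ (latOrder d + 1))⁻¹ := by positivity
  calc ‖mFourierCoeff (fun y => Ul y * Uj y) k - mFourierCoeff (Torus.partialDeriv j Ul) k -
          mFourierCoeff (Torus.partialDeriv l Uj) k‖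
      ≤ ‖mFourierCoeff (fun y => Ul y * Uj y) k‖ + ‖mFourierCoeff (Torus.partialDeriv j Ul) k‖ +
          ‖mFourierCoeff (Torus.partialDeriv l Uj) k‖ := by
        have := norm_sub_le (mFourierCoeff (fun y => Ul y * Uj y) k) (mFourierCoeff (Torus.partialDeriv j Ul) k)
        linarith [norm_sub_le (mFourierCoeff (fun y => Ul y * Uj y) k - mFourierCoeff (Torus.partialDeriv j Ul) k)
          (mFourierCoeff (Torus.partialDeriv l Uj) k)]
    _ ≤ _ := by
        have h1 := hprod k; have h2 := hd1 k; have h3 := hd2 k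
        dsimp only at h1 h2 h3
        nlinarith [h1, h2, h3, hw]

/-- **Local classical solutions at unit viscosity, driven by the time derivative of a background.**  For every
level `A ≥ 0` there is `θ₀ ∈ (0, 1]` (Cheskidov–Luo's threshold for the radius `1` and the decay constants
computed from `A`) such that: for every `T > 0` and every `U` jointly smooth with divergence-free slices on
`[0, T] × T^d` whose component Fourier coefficients satisfy `‖𝓕(Uⱼ(t))(k)‖ ≤ A (1 + ‖k‖)^{-(2#d+2)}` for all
`t ∈ [0, T]`, and every `0 < θ ≤ min θ₀ T`, the Navier–Stokes system at unit viscosity with the force `∂ₜU`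
(one-sided derivative within `[0, T]`) has a classical solution `(u, p)` on `[0, θ] × T^d` with `u(0) = U(0)`:
`u = U + v` with the Fourier–Picard corrector `v` of `CorrectorFourier.isLinearizedNSSolutionOn_vel` for the
stress `½(U⊗U + U⊗U) − (∇U + ∇Uᵀ)` (Majda–Bertozzi 2002, Thm. 3.4: life span from the size of datum and force;
Cheskidov–Luo 2022, Prop. 3.2). [cite: MajdaBertozziCUP2002, Thm. 3.4] -/
theorem Torus.exists_classicalNS_unitVisc_of_background {A : ℝ} (hA : 0 ≤ A) :
    ∃ θ₀ : ℝ, 0 < θ₀ ∧ θ₀ ≤ 1 ∧ ∀ {T : ℝ} {U : ℝ → UnitAddTorus d → EuclideanSpace ℝ d}, 0 < T →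
      Torus.IsSmoothSpaceTimeOn (Icc 0 T) U → (∀ t ∈ Icc 0 T, Torus.IsDivFree (U t)) →
      (∀ t ∈ Icc 0 T, ∀ j, HasDecay (latOrder d + 2) A (fun k => mFourierCoeff (fun x => ((U t x j : ℝ) : ℂ)) k)) →
      ∀ θ : ℝ, 0 < θ → θ ≤ θ₀ → θ ≤ T →
        ∃ (u : ℝ → UnitAddTorus d → EuclideanSpace ℝ d) (p : ℝ → UnitAddTorus d → ℝ),
          Torus.IsClassicalNSSolutionOn (Icc 0 θ) 1 (Torus.timeDerivWithin (Icc 0 T) U) u p ∧ u 0 = U 0 := by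
  set B : ℝ := 2 ^ (latOrder d + 1) * latMass d * (A * A + A * A) + 2 * Real.pi * A + 2 * Real.pi * A with hB
  have hlm := latMass_nonneg (d := d)
  have hB0 : 0 ≤ B := by positivity
  obtain ⟨θ₀, hθ₀, hθ₀1, hthr⟩ := CorrectorFourier.exists_threshold (d := d) one_pos hA hB0
  refine ⟨θ₀, hθ₀, hθ₀1, ?_⟩
  intro T U hT hU hUdiv hUA θ hθ hθle hθT
  obtain ⟨hS1, hS2⟩ := hthr θ hθ hθle
  have hθ1 : θ ≤ 1 := hθle.trans hθ₀1
  have hsub : Icc (0 : ℝ) θ ⊆ Icc 0 T := Icc_subset_Icc_right hθT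
  have hUD : UniqueDiffOn ℝ (Icc 0 θ) := uniqueDiffOn_Icc hθ
  have hUθ : Torus.IsSmoothSpaceTimeOn (Icc 0 θ) U := hU.mono hsub
  have hUdivθ : ∀ t ∈ Icc (0 : ℝ) θ, Torus.IsDivFree (U t) := fun t ht => hUdiv t (hsub ht)
  -- the stress and its smoothness
  set R : ℝ → UnitAddTorus d → d → EuclideanSpace ℝ d :=
    fun t y j => (1 / 2 : ℝ) • Torus.linStress (U t) (U t) y j - Torus.symGrad (U t) y j with hRdef
  have hR : Torus.IsSmoothSpaceTimeOn (Icc 0 θ) R := by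
    have h1 := ((hUθ.linStress hUθ).const_smul (1 / 2 : ℝ)).sub (hUθ.symGrad hUD)
    exact h1
  -- decay of the clamped drift and stress coefficients
  have hUA' : ∀ j t, HasDecay (latOrder d + 1) A (driftCoeff θ U j t) :=
    hasDecay_driftCoeff_of_forall hθ.le fun s hs j => by
      have h := (hUA s (hsub hs) j).of_le (show latOrder d + 1 ≤ latOrder d + 2 by omega)
      exact h
  have hRB : ∀ l j t, HasDecay (latOrder d + 1) B (stressCoeff θ R l j t) :=
    hasDecay_stressCoeff_of_forall hθ.le fun s hs l j => by
      have h := Torus.hasDecay_backgroundStress_entry (hU.isSmooth_slice (hsub hs)) hA (hUA s (hsub hs)) l j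
      exact h
  obtain ⟨hsol, -⟩ :=
    CorrectorFourier.isLinearizedNSSolutionOn_vel hθ hθ1 hUθ hUdivθ hR zero_le_one hA hB0 hUA' hRB hS1 hS2
  obtain ⟨hNS, h0⟩ := Torus.IsClassicalNSSolutionOn.of_background_corrector hθ hUθ hUdivθ hsol
  refine ⟨_, _, hNS.congr_force fun t ht x => ?_, h0⟩
  -- the derivative within the small window is the derivative within `[0, T]`
  exact ((hU.hasDerivWithinAt_slice (hsub ht) x).mono hsub).derivWithin (hUD t ht)

end UnitVisc

/-! ### §5 The restart theorem for a time-dependent force in potential form -/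

section Restart

variable {ν a b : ℝ} {ū f : ℝ → UnitAddTorus d → EuclideanSpace ℝ d}

/-- Uniform polynomial decay, of any order, of the component Fourier coefficients of a field jointly smooth
on a compact time interval (the tree's `ScalarFourier.exists_hasDecay_mFourierCoeff_spaceTime`, component by
component, after translating `[a, b]` to `[0, b − a]`). [folklore] -/
private theorem Torus.exists_hasDecay_components (hab : a < b) (hū : Torus.IsSmoothSpaceTimeOn (Icc a b) ū)
    (K : ℕ) : ∃ C : ℝ, 0 ≤ C ∧ ∀ t ∈ Icc a b, ∀ j,
      HasDecay K C (fun k => mFourierCoeff (fun x => ((ū t x j : ℝ) : ℂ)) k) := by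
  -- translate to `[0, b - a]`
  set w : ℝ → UnitAddTorus d → EuclideanSpace ℝ d := fun s => ū (s + a) with hw
  have hpre : (· + a) ⁻¹' Icc a b = Icc 0 (b - a) := by
    rw [Torus.preimage_add_const_Icc', sub_self]
  have hws : Torus.IsSmoothSpaceTimeOn (Icc 0 (b - a)) w := by
    have h1 := hū.comp_add_const a
    rwa [hpre] at h1
  have hT : 0 < b - a := sub_pos.2 hab
  have hj : ∀ j : d, ∃ C : ℝ, 0 ≤ C ∧ ∀ s ∈ Icc 0 (b - a),
      HasDecay K C (fun k => mFourierCoeff (compC w j s) k) := fun j =>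
    exists_hasDecay_mFourierCoeff_spaceTime hT (isSmoothSpaceTimeOn_compC hws j) K
  choose C hC0 hC using hj
  refine ⟨∑ j, C j, Finset.sum_nonneg fun j _ => hC0 j, fun t ht j => ?_⟩
  have hs : t - a ∈ Icc 0 (b - a) := ⟨by linarith [ht.1], by linarith [ht.2]⟩
  have h := (hC j (t - a) hs).mono (Finset.single_le_sum (fun i _ => hC0 i) (Finset.mem_univ j))
  have e : compC w j (t - a) = fun x => ((ū t x j : ℝ) : ℂ) := by
    funext x; simp [hw]
  rw [e] at h
  exact h

/-- **The restart theorem: local classical solutions of the forced Navier–Stokes system on `T^d` from an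
arbitrary smooth datum at an arbitrary start time, with a uniform life span.**  Let `ν > 0`, `a < b`, let
`ū` be jointly smooth with divergence-free slices on `[a, b] × T^d`, let the force `f` be its one-sided time
derivative there (`∂ₜū = f` on `[a, b]`; every smooth force has such a primitive), and let `M` be a level.  Then
there is `θ > 0` — depending on `d, ν, ū, M` only — such that: for every start time `t₀ ∈ [a, b]`, every
length `0 < θ' ≤ θ` with `t₀ + θ' ≤ b`, and every smooth divergence-free datum `u₀` with
`‖𝓕(u₀ⱼ)(k)‖ ≤ M (1 + ‖k‖)^{-(2#d+2)}` for all `j, k`, the system `∂ₜu + (u·∇)u = νΔu − ∇p + f`, `div u = 0`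
has a classical solution `(u, p)` on `[t₀, t₀ + θ'] × T^d` with `u(t₀) = u₀`.  Proof: background
`U = u₀ − ū(t₀) + ū` in the unit-viscosity variables `s = ν(t − t₀)` (`U₁(s) = ν⁻¹U(t₀ + s/ν)`, decay level
`ν⁻¹(M + 2Ā)` with `Ā` the level of `ū` on `[a, b]`), `Torus.exists_classicalNS_unitVisc_of_background`, and
the parabolic rescaling `rescale_translate` (`ν² ∂ₛU₁(ν(t − t₀)) = ∂ₜū(t) = f(t)`).  This is the uniform
local existence statement consumed by continuation arguments (Majda–Bertozzi 2002, Thm. 3.4 with §3.2.3;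
Constantin–Foias 1988, Thm. 9.4 / Ch. 10 p. 55: "a time interval `[0, T₀]` whose length depends on the size
of `|f|` and of `‖v(0)‖`"). [cite: MajdaBertozziCUP2002, Thm. 3.4] -/
theorem Torus.exists_classicalNS_forced_restart (hν : 0 < ν) (hab : a < b)
    (hū : Torus.IsSmoothSpaceTimeOn (Icc a b) ū) (hūdiv : ∀ t ∈ Icc a b, Torus.IsDivFree (ū t))
    (hf : ∀ t ∈ Icc a b, ∀ x, Torus.timeDerivWithin (Icc a b) ū t x = f t x) (M : ℝ) :
    ∃ θ : ℝ, 0 < θ ∧ ∀ t₀ ∈ Icc a b, ∀ θ' : ℝ, 0 < θ' → θ' ≤ θ → t₀ + θ' ≤ b →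
      ∀ u₀ : UnitAddTorus d → EuclideanSpace ℝ d, Torus.IsSmooth u₀ → Torus.IsDivFree u₀ →
        (∀ j, HasDecay (latOrder d + 2) M (fun k => mFourierCoeff (fun x => ((u₀ x j : ℝ) : ℂ)) k)) →
        ∃ (u : ℝ → UnitAddTorus d → EuclideanSpace ℝ d) (p : ℝ → UnitAddTorus d → ℝ),
          Torus.IsClassicalNSSolutionOn (Icc t₀ (t₀ + θ')) ν f u p ∧ u t₀ = u₀ := by
  -- the decay level of the background in unit-viscosity variables and its threshold
  obtain ⟨Abar, hAbar0, hAbar⟩ := Torus.exists_hasDecay_components hab hū (latOrder d + 2)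
  set M' : ℝ := max M 0 with hM'
  have hM'0 : 0 ≤ M' := le_max_right _ _
  set A : ℝ := ν⁻¹ * (M' + Abar + Abar) with hAdef
  have hA : 0 ≤ A := by positivity
  obtain ⟨θ₀, hθ₀, -, hloc⟩ := Torus.exists_classicalNS_unitVisc_of_background (d := d) hA
  refine ⟨θ₀ / ν, div_pos hθ₀ hν, ?_⟩
  intro t₀ ht₀ θ' hθ' hθ'le hθ'b u₀ hu₀ hu₀div hu₀M
  have ht₀b : t₀ < b := by linarith
  -- the background in unit-viscosity variables on `[0, T]`, `T = ν (b - t₀)`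
  set T : ℝ := ν * (b - t₀) with hTdef
  have hT : 0 < T := mul_pos hν (sub_pos.2 ht₀b)
  set U : ℝ → UnitAddTorus d → EuclideanSpace ℝ d :=
    fun s x => ν⁻¹ • (u₀ x - ū t₀ x + ū (t₀ + ν⁻¹ * s) x) with hUdef
  have hmaps : MapsTo (fun s : ℝ => t₀ + ν⁻¹ * s) (Icc 0 T) (Icc a b) := fun s hs => by
    refine ⟨by nlinarith [ht₀.1, hs.1, inv_pos.2 hν], ?_⟩
    have h1 : ν⁻¹ * s ≤ ν⁻¹ * T := mul_le_mul_of_nonneg_left hs.2 (inv_pos.2 hν).le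
    have h2 : ν⁻¹ * T = b - t₀ := by rw [hTdef, ← mul_assoc, inv_mul_cancel₀ hν.ne', one_mul]
    linarith
  have hūt₀ : Torus.IsSmooth (ū t₀) := hū.isSmooth_slice ht₀
  -- joint smoothness of `U`
  have hφ : ContDiff ℝ ((⊤ : ℕ∞) : WithTop ℕ∞)
      (fun z : ℝ × EuclideanSpace ℝ d => ((t₀ + ν⁻¹ * z.1, z.2) : ℝ × EuclideanSpace ℝ d)) :=
    (contDiff_const.add (contDiff_const.mul contDiff_fst)).prodMk contDiff_snd
  have hφmaps : MapsTo (fun z : ℝ × EuclideanSpace ℝ d => ((t₀ + ν⁻¹ * z.1, z.2) : ℝ × EuclideanSpace ℝ d))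
      (Icc 0 T ×ˢ univ) (Icc a b ×ˢ univ) := fun z hz =>
    mk_mem_prod (hmaps (mem_prod.1 hz).1) (mem_univ _)
  have hUs : Torus.IsSmoothSpaceTimeOn (Icc 0 T) U := by
    have h1 : Torus.IsSmoothSpaceTimeOn (Icc 0 T) (fun s x => ū (t₀ + ν⁻¹ * s) x) :=
      hū.comp hφ.contDiffOn hφmaps
    have h2 : Torus.IsSmoothSpaceTimeOn (Icc 0 T) (fun _ : ℝ => fun x => u₀ x - ū t₀ x) :=
      Torus.isSmoothSpaceTimeOn_const (hu₀.sub hūt₀) _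
    exact (h2.add h1).const_smul ν⁻¹
  -- divergence-free slices
  have hUdiv : ∀ s ∈ Icc 0 T, Torus.IsDivFree (U s) := by
    intro s hs
    have hmem := hmaps hs
    have hūt : Torus.IsSmooth (ū (t₀ + ν⁻¹ * s)) := hū.isSmooth_slice hmem
    have h1 : Torus.IsDivFree (fun x => u₀ x - ū t₀ x) := fun x => by
      rw [show (fun x => u₀ x - ū t₀ x) = u₀ - ū t₀ from rfl,
        Torus.divergence_sub (hu₀.isContDiff (by simp)) (hūt₀.isContDiff (by simp)), hu₀div x,
        hūdiv t₀ ht₀ x, sub_zero]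
    have h2 : Torus.IsDivFree (fun x => (u₀ x - ū t₀ x) + ū (t₀ + ν⁻¹ * s) x) :=
      Torus.IsDivFree.add ((hu₀.sub hūt₀).isContDiff (by simp)) (hūt.isContDiff (by simp)) h1
        (hūdiv _ hmem)
    intro x
    have h12 : Torus.IsContDiff 1 (fun x => (u₀ x - ū t₀ x) + ū (t₀ + ν⁻¹ * s) x) :=
      ((hu₀.sub hūt₀).add hūt).isContDiff (by simp)
    rw [show U s = ν⁻¹ • (fun x => (u₀ x - ū t₀ x) + ū (t₀ + ν⁻¹ * s) x) from rfl,
      Torus.divergence_const_smul h12, h2 x, mul_zero]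
  -- decay of the components of `U`
  have hUA : ∀ s ∈ Icc 0 T, ∀ j,
      HasDecay (latOrder d + 2) A (fun k => mFourierCoeff (fun x => ((U s x j : ℝ) : ℂ)) k) := by
    intro s hs j
    have hmem := hmaps hs
    have hūt : Torus.IsSmooth (ū (t₀ + ν⁻¹ * s)) := hū.isSmooth_slice hmem
    set g₁ : UnitAddTorus d → ℂ := fun x => ((u₀ x j : ℝ) : ℂ) with hg₁
    set g₂ : UnitAddTorus d → ℂ := fun x => ((ū t₀ x j : ℝ) : ℂ) with hg₂
    set g₃ : UnitAddTorus d → ℂ := fun x => ((ū (t₀ + ν⁻¹ * s) x j : ℝ) : ℂ) with hg₃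
    have hs₁ : Torus.IsSmooth g₁ := (hu₀.apply j).comp_clm Complex.ofRealCLM
    have hs₂ : Torus.IsSmooth g₂ := (hūt₀.apply j).comp_clm Complex.ofRealCLM
    have hs₃ : Torus.IsSmooth g₃ := (hūt.apply j).comp_clm Complex.ofRealCLM
    have e : (fun x => ((U s x j : ℝ) : ℂ)) = ((ν⁻¹ : ℝ) : ℂ) • ((g₁ - g₂) + g₃) := by
      funext x
      simp only [hUdef, hg₁, hg₂, hg₃, PiLp.smul_apply, PiLp.add_apply, PiLp.sub_apply, smul_eq_mul,
        Pi.smul_apply, Pi.add_apply, Pi.sub_apply]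
      push_cast
      ring
    rw [e]
    intro k
    dsimp only
    rw [Torus.mFourierCoeff_const_smul, Torus.mFourierCoeff_add (hs₁.integrable.sub hs₂.integrable) hs₃.integrable,
      Torus.mFourierCoeff_sub hs₁.integrable hs₂.integrable, norm_smul]
    have h1 := (hu₀M j).mono (le_max_left M 0) k
    have h2 := hAbar t₀ ht₀ j k
    have h3 := hAbar _ hmem j k
    dsimp only at h1 h2 h3
    have hw : 0 ≤ ((1 + ‖k‖) ^ (latOrder d + 2))⁻¹ := by positivity
    have hn : ‖((ν⁻¹ : ℝ) : ℂ)‖ = ν⁻¹ := by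
      rw [Complex.norm_real, Real.norm_of_nonneg (inv_pos.2 hν).le]
    rw [hn, hAdef]
    have htri : ‖mFourierCoeff g₁ k - mFourierCoeff g₂ k + mFourierCoeff g₃ k‖ ≤
        ‖mFourierCoeff g₁ k‖ + ‖mFourierCoeff g₂ k‖ + ‖mFourierCoeff g₃ k‖ := by
      linarith [norm_add_le (mFourierCoeff g₁ k - mFourierCoeff g₂ k) (mFourierCoeff g₃ k),
        norm_sub_le (mFourierCoeff g₁ k) (mFourierCoeff g₂ k)]
    calc ν⁻¹ * ‖mFourierCoeff g₁ k - mFourierCoeff g₂ k + mFourierCoeff g₃ k‖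
        ≤ ν⁻¹ * ((M' + Abar + Abar) * ((1 + ‖k‖) ^ (latOrder d + 2))⁻¹) := by
          refine mul_le_mul_of_nonneg_left (htri.trans ?_) (inv_pos.2 hν).le
          nlinarith [h1, h2, h3, hw]
      _ = ν⁻¹ * (M' + Abar + Abar) * ((1 + ‖k‖) ^ (latOrder d + 2))⁻¹ := by ring
  -- the unit-viscosity solution on `[0, ν θ']`
  have hνθ' : 0 < ν * θ' := mul_pos hν hθ'
  have hνθ'le : ν * θ' ≤ θ₀ := by
    have := mul_le_mul_of_nonneg_left hθ'le hν.le
    rwa [mul_div_cancel₀ _ hν.ne'] at this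
  have hνθ'T : ν * θ' ≤ T := by
    rw [hTdef]; exact mul_le_mul_of_nonneg_left (by linarith) hν.le
  obtain ⟨w, q, hw, hw0⟩ := hloc hT hUs hUdiv hUA (ν * θ') hνθ' hνθ'le hνθ'T
  -- rescale back: viscosity `ν`, window `[t₀, t₀ + θ']`
  have hres := hw.rescale_translate (t₀ := t₀) hν hνθ'
  rw [mul_one, mul_div_cancel_left₀ θ' hν.ne'] at hres
  refine ⟨_, _, hres.congr_force fun t ht x => ?_, ?_⟩
  · -- `ν² ∂ₛU(ν(t - t₀)) = ∂ₜū(t) = f(t)`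
    have hst : ν * (t - t₀) ∈ Icc 0 T := by
      refine ⟨mul_nonneg hν.le (by linarith [ht.1]), ?_⟩
      rw [hTdef]; exact mul_le_mul_of_nonneg_left (by linarith [ht.2]) hν.le
    have htab : t ∈ Icc a b := ⟨ht₀.1.trans ht.1, by linarith [ht.2]⟩
    have hback : t₀ + ν⁻¹ * (ν * (t - t₀)) = t := by
      rw [← mul_assoc, inv_mul_cancel₀ hν.ne', one_mul]; ring
    -- the derivative of `U` within `[0, T]` at `s = ν (t - t₀)`
    have hUD : UniqueDiffOn ℝ (Icc 0 T) := uniqueDiffOn_Icc hT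
    have hder : Torus.timeDerivWithin (Icc 0 T) U (ν * (t - t₀)) x =
        ν⁻¹ • (ν⁻¹ • Torus.timeDerivWithin (Icc a b) ū t x) := by
      have hg : HasDerivWithinAt (fun τ => ū τ x) (Torus.timeDerivWithin (Icc a b) ū t x) (Icc a b)
          (t₀ + ν⁻¹ * (ν * (t - t₀))) := by
        rw [hback]; exact hū.hasDerivWithinAt_slice htab x
      have hh : HasDerivWithinAt (fun s : ℝ => t₀ + ν⁻¹ * s) ν⁻¹ (Icc 0 T) (ν * (t - t₀)) := by
        simpa using ((hasDerivWithinAt_id (ν * (t - t₀)) (Icc 0 T)).const_mul ν⁻¹).const_add t₀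
      have hcomp := hg.scomp (ν * (t - t₀)) hh hmaps
      have hconst : HasDerivWithinAt (fun _ : ℝ => u₀ x - ū t₀ x) 0 (Icc 0 T) (ν * (t - t₀)) :=
        hasDerivWithinAt_const _ _ _
      have hsum := ((hconst.add hcomp).const_smul ν⁻¹)
      simp only [zero_add] at hsum
      exact hsum.derivWithin (hUD _ hst)
    rw [hder, hf t htab x, smul_smul, smul_smul, pow_two]
    rw [show ν * ν * ν⁻¹ * ν⁻¹ = 1 by field_simp, one_smul]
  · funext x
    show ν • w (ν * (t₀ - t₀)) x = u₀ x
    rw [sub_self, mul_zero, hw0]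
    simp only [hUdef, mul_zero, add_zero, sub_add_cancel, smul_smul, mul_inv_cancel₀ hν.ne', one_smul]

/-- **Local classical solutions of the forced Navier–Stokes system from a smooth datum** (qualitative
corollary of the restart theorem at the initial time): for `ν > 0`, `a < b`, `ū` jointly smooth with
divergence-free slices on `[a, b] × T^d` with `∂ₜū = f` there, and a smooth divergence-free datum `u₀`,
there are `θ > 0` with `a + θ ≤ b` and a classical solution `(u, p)` of `∂ₜu + (u·∇)u = νΔu − ∇p + f`,
`div u = 0` on `[a, a + θ] × T^d` with `u(a) = u₀` (Majda–Bertozzi 2002, Thm. 3.4; Robinson–Rodrigo–Sadowski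
2016, Thm. 6.8). [cite: MajdaBertozziCUP2002, Thm. 3.4] -/
theorem Torus.exists_classicalNS_forced_local (hν : 0 < ν) (hab : a < b)
    (hū : Torus.IsSmoothSpaceTimeOn (Icc a b) ū) (hūdiv : ∀ t ∈ Icc a b, Torus.IsDivFree (ū t))
    (hf : ∀ t ∈ Icc a b, ∀ x, Torus.timeDerivWithin (Icc a b) ū t x = f t x)
    {u₀ : UnitAddTorus d → EuclideanSpace ℝ d} (hu₀ : Torus.IsSmooth u₀) (hu₀div : Torus.IsDivFree u₀) :
    ∃ θ : ℝ, 0 < θ ∧ a + θ ≤ b ∧ ∃ (u : ℝ → UnitAddTorus d → EuclideanSpace ℝ d) (p : ℝ → UnitAddTorus d → ℝ),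
      Torus.IsClassicalNSSolutionOn (Icc a (a + θ)) ν f u p ∧ u a = u₀ := by
  -- a decay level of the datum
  have hj : ∀ j : d, ∃ C : ℝ, 0 ≤ C ∧
      HasDecay (latOrder d + 2) C (fun k => mFourierCoeff (fun x => ((u₀ x j : ℝ) : ℂ)) k) := fun j =>
    exists_hasDecay_mFourierCoeff ((hu₀.apply j).comp_clm Complex.ofRealCLM) (latOrder d + 2)
  choose C hC0 hC using hj
  have hM : ∀ j, HasDecay (latOrder d + 2) (∑ i, C i) (fun k => mFourierCoeff (fun x => ((u₀ x j : ℝ) : ℂ)) k) :=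
    fun j => (hC j).mono (Finset.single_le_sum (fun i _ => hC0 i) (Finset.mem_univ j))
  obtain ⟨θ, hθ, hrestart⟩ := Torus.exists_classicalNS_forced_restart hν hab hū hūdiv hf (∑ i, C i)
  set θ' : ℝ := min θ (b - a) with hθ'
  have hθ'0 : 0 < θ' := lt_min hθ (sub_pos.2 hab)
  have hθ'b : a + θ' ≤ b := by have := min_le_right θ (b - a); linarith
  obtain ⟨u, p, hu, hu0⟩ := hrestart a ⟨le_rfl, hab.le⟩ θ' hθ'0 (min_le_left _ _) hθ'b u₀ hu₀ hu₀div hM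
  exact ⟨θ', hθ'0, hθ'b, u, p, hu, hu0⟩

end Restart

end Literature.Analysis.FluidPDE

end
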